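import Summits.Ventures.LatticeQCDFlow.Scoring.UNOnePlaquetteCumulants
import Mathlib.Analysis.Calculus.ParametricIntegral
import HarnessLib

/-!
# The `U(1)`-centre Ward identity of the `U(N)` one-plaquette law, every `N`: `β ⟨(Im tr U)²⟩_β = ⟨Re tr U⟩_β`

HONEST FRAMING: exact (Metropolis-corrected) sampling algorithms for lattice gauge theory;
figures of merit are autocorrelation/cost numbers at stated couplings and volumes; no
continuum-physics claim.

Venture `LatticeQCDFlow` (cell pub-lqcd), sub-topic `Scoring`; FANOUT row 5 (`s0-sun-a`), GEN-20.
NEW WORK of the cell (placement rule).  Row 5's `SchwingerDysonOnePlaquette` has the `U(1)` identity `⟨cos θ⟩_β = β⟨sin² θ⟩_β`.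
Here its every-`N` form for the `U(N)` one-plaquette (= 2-d infinite-volume, GEN-19 (24)) law `∝ e^{−β(N − Re tr U)} dU`: the
Haar measure is invariant under the CENTRAL phase `U ↦ e^{iα} U`, under which `tr U ↦ e^{iα} tr U`; differentiating
`α ↦ ∫ Im tr(e^{iα}U) e^{β Re tr(e^{iα}U)} dU` (constant in `α`) at `α = 0` under the integral sign gives the Schwinger–Dyson /
Ward identity of the `U(1)` factor:

* §1 `exp_mul_I_smul_one_mem_unitaryGroup`, `trace_centre_mul` (`tr(e^{iα}·U) = e^{iα} tr U`), `abs_trace_im_le_card`;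
* §2 **`integral_trace_re_sub_mul_im_sq_mul_exp`** — `∫_{U(N)} (Re tr U − β (Im tr U)²) e^{β Re tr U} dU = 0` for every `N` and
  every real `β`, i.e. **`mul_integral_trace_im_sq_mul_exp`**: `β ∫ (Im tr U)² e^{β Re tr U} dU = ∫ Re tr U e^{β Re tr U} dU`;
* §3 the normalised forms: **`unitary_mul_trace_im_sq_eq_plaquette`** — `β ⟨(Im tr U)²⟩_β = N · P_N(β)` (the plaquette
  `P_N = ⟨N⁻¹ Re tr U⟩_β`), and **`tendsto_mul_unitary_trace_im_sq_atTop`** — `β ⟨(Im tr U_p)²⟩_β → N` as `β → ∞` (GEN-17: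
  `P_N → 1`): at weak coupling `(Im tr U_p)²` has mean `N/β · (1 + o(1))` (the `U(1)` phase mode of `U(N) = U(1) ×_{ℤ_N} SU(N)`).

No `def`, nothing cited as a fact, 0 sorry.
-/

noncomputable section

open Real MeasureTheory Filter Topology Finset
open Complex (I)
open ProbabilityTheory
open Literature.MathematicalPhysics.QuantumFieldTheory (haarProbability)
open Literature.Analysis.FunctionSpaces (besselI)

namespace Summit.Ventures.LatticeQCDFlow.Scoring

/-! ### 1. The central phases of `U(N)` -/

/-- The central phase `e^{iα}·1 ∈ U(N)`. -/
theorem exp_mul_I_smul_one_mem_unitaryGroup (N : ℕ) (α : ℝ) :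
    Complex.exp (α * I) • (1 : Matrix (Fin N) (Fin N) ℂ) ∈ Matrix.unitaryGroup (Fin N) ℂ := by
  rw [Matrix.mem_unitaryGroup_iff, star_smul, star_one, Matrix.smul_mul, Matrix.mul_smul, one_mul, smul_smul,
    Complex.star_def, Complex.mul_conj, Complex.normSq_eq_norm_sq, Complex.norm_exp_ofReal_mul_I]
  simp

/-- `tr((e^{iα}·1) U) = e^{iα} · tr U`. -/
theorem trace_centre_mul (N : ℕ) (α : ℝ) (u : Matrix.unitaryGroup (Fin N) ℂ) :
    (((⟨Complex.exp (α * I) • 1, exp_mul_I_smul_one_mem_unitaryGroup N α⟩ * u : Matrix.unitaryGroup (Fin N) ℂ) :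
      Matrix (Fin N) (Fin N) ℂ)).trace = Complex.exp (α * I) * ((u : Matrix (Fin N) (Fin N) ℂ)).trace := by
  show (((Complex.exp (α * I) • (1 : Matrix (Fin N) (Fin N) ℂ)) * (u : Matrix (Fin N) (Fin N) ℂ))).trace = _
  rw [Matrix.smul_mul, one_mul, Matrix.trace_smul, smul_eq_mul]

/-- `Re tr(e^{iα} U) = cos α · Re tr U − sin α · Im tr U`. -/
theorem trace_centre_mul_re (N : ℕ) (α : ℝ) (u : Matrix.unitaryGroup (Fin N) ℂ) :
    (((⟨Complex.exp (α * I) • 1, exp_mul_I_smul_one_mem_unitaryGroup N α⟩ * u : Matrix.unitaryGroup (Fin N) ℂ) :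
      Matrix (Fin N) (Fin N) ℂ)).trace.re
      = Real.cos α * ((u : Matrix (Fin N) (Fin N) ℂ)).trace.re - Real.sin α * ((u : Matrix (Fin N) (Fin N) ℂ)).trace.im := by
  rw [trace_centre_mul, Complex.mul_re, Complex.exp_ofReal_mul_I_re, Complex.exp_ofReal_mul_I_im]

/-- `Im tr(e^{iα} U) = sin α · Re tr U + cos α · Im tr U`. -/
theorem trace_centre_mul_im (N : ℕ) (α : ℝ) (u : Matrix.unitaryGroup (Fin N) ℂ) :
    (((⟨Complex.exp (α * I) • 1, exp_mul_I_smul_one_mem_unitaryGroup N α⟩ * u : Matrix.unitaryGroup (Fin N) ℂ) :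
      Matrix (Fin N) (Fin N) ℂ)).trace.im
      = Real.sin α * ((u : Matrix (Fin N) (Fin N) ℂ)).trace.re + Real.cos α * ((u : Matrix (Fin N) (Fin N) ℂ)).trace.im := by
  rw [trace_centre_mul, Complex.mul_im, Complex.exp_ofReal_mul_I_re, Complex.exp_ofReal_mul_I_im]
  ring

/-- `|Im tr U| ≤ N` on `U(N)`. -/
theorem abs_trace_im_le_card {n : Type*} [Fintype n] [DecidableEq n] (u : Matrix.unitaryGroup n ℂ) :
    |((u : Matrix.unitaryGroup n ℂ) : Matrix n n ℂ).trace.im| ≤ Fintype.card n := by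
  rw [Matrix.trace, Complex.im_sum]
  calc |∑ i, (((u : Matrix.unitaryGroup n ℂ) : Matrix n n ℂ) i i).im|
      ≤ ∑ i, |(((u : Matrix.unitaryGroup n ℂ) : Matrix n n ℂ) i i).im| := Finset.abs_sum_le_sum_abs _ _
    _ ≤ ∑ _i : n, (1 : ℝ) := Finset.sum_le_sum fun i _ =>
        (Complex.abs_im_le_norm _).trans (entry_norm_bound_of_unitary u.2 i i)
    _ = Fintype.card n := by simp

/-! ### 2. The Ward identity -/

/-- **The `U(1)`-centre Ward identity**: `∫_{U(N)} (Re tr U − β (Im tr U)²) e^{β Re tr U} dU = 0`, every `N`, every real `β`. -/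
theorem integral_trace_re_sub_mul_im_sq_mul_exp (N : ℕ) (β : ℝ) :
    ∫ u, ((((u : Matrix.unitaryGroup (Fin N) ℂ) : Matrix (Fin N) (Fin N) ℂ).trace.re
        - β * ((u : Matrix.unitaryGroup (Fin N) ℂ) : Matrix (Fin N) (Fin N) ℂ).trace.im ^ 2) *
        Real.exp (β * ((u : Matrix.unitaryGroup (Fin N) ℂ) : Matrix (Fin N) (Fin N) ℂ).trace.re))
      ∂(haarProbability (Matrix.unitaryGroup (Fin N) ℂ)) = 0 := by
  set μ := haarProbability (Matrix.unitaryGroup (Fin N) ℂ) with hμ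
  -- the rotated integrand and its `α`-derivative
  set F : ℝ → Matrix.unitaryGroup (Fin N) ℂ → ℝ := fun α u =>
    (Real.sin α * ((u : Matrix (Fin N) (Fin N) ℂ)).trace.re + Real.cos α * ((u : Matrix (Fin N) (Fin N) ℂ)).trace.im) *
      Real.exp (β * (Real.cos α * ((u : Matrix (Fin N) (Fin N) ℂ)).trace.re
        - Real.sin α * ((u : Matrix (Fin N) (Fin N) ℂ)).trace.im)) with hF
  set F' : ℝ → Matrix.unitaryGroup (Fin N) ℂ → ℝ := fun α u =>
    ((Real.cos α * ((u : Matrix (Fin N) (Fin N) ℂ)).trace.re - Real.sin α * ((u : Matrix (Fin N) (Fin N) ℂ)).trace.im)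
      - β * (Real.sin α * ((u : Matrix (Fin N) (Fin N) ℂ)).trace.re + Real.cos α * ((u : Matrix (Fin N) (Fin N) ℂ)).trace.im) ^ 2) *
      Real.exp (β * (Real.cos α * ((u : Matrix (Fin N) (Fin N) ℂ)).trace.re
        - Real.sin α * ((u : Matrix (Fin N) (Fin N) ℂ)).trace.im)) with hF'
  have htr : Continuous fun u : Matrix.unitaryGroup (Fin N) ℂ => ((u : Matrix (Fin N) (Fin N) ℂ)).trace :=
    continuous_subtype_val.matrix_trace
  have hR : Continuous fun u : Matrix.unitaryGroup (Fin N) ℂ => ((u : Matrix (Fin N) (Fin N) ℂ)).trace.re :=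
    Complex.continuous_re.comp htr
  have hJ : Continuous fun u : Matrix.unitaryGroup (Fin N) ℂ => ((u : Matrix (Fin N) (Fin N) ℂ)).trace.im :=
    Complex.continuous_im.comp htr
  have hcont : ∀ α, Continuous (F α) := fun α => by
    simp only [hF]
    exact ((continuous_const.mul hR).add (continuous_const.mul hJ)).mul
      (Real.continuous_exp.comp (continuous_const.mul ((continuous_const.mul hR).sub (continuous_const.mul hJ))))
  have hcont' : ∀ α, Continuous (F' α) := fun α => by
    simp only [hF']
    exact (((continuous_const.mul hR).sub (continuous_const.mul hJ)).sub
      (continuous_const.mul (((continuous_const.mul hR).add (continuous_const.mul hJ)).pow 2))).mul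
      (Real.continuous_exp.comp (continuous_const.mul ((continuous_const.mul hR).sub (continuous_const.mul hJ))))
  -- invariance: `∫ F α = ∫ F 0` for every `α`
  have hrot : ∀ α, ∫ u, F α u ∂μ = ∫ u, F 0 u ∂μ := by
    intro α
    have key := integral_mul_left_eq_self (μ := μ)
      (fun u : Matrix.unitaryGroup (Fin N) ℂ => ((u : Matrix (Fin N) (Fin N) ℂ)).trace.im *
        Real.exp (β * ((u : Matrix (Fin N) (Fin N) ℂ)).trace.re))
      ⟨Complex.exp (α * I) • 1, exp_mul_I_smul_one_mem_unitaryGroup N α⟩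
    simp only [trace_centre_mul_re, trace_centre_mul_im] at key
    have h0 : ∀ u : Matrix.unitaryGroup (Fin N) ℂ, F 0 u = ((u : Matrix (Fin N) (Fin N) ℂ)).trace.im *
        Real.exp (β * ((u : Matrix (Fin N) (Fin N) ℂ)).trace.re) := fun u => by
      simp only [hF, Real.sin_zero, Real.cos_zero, zero_mul, one_mul, zero_add, sub_zero]
    simp_rw [h0]
    exact key
  -- pointwise derivative in `α`
  have hderiv : ∀ u : Matrix.unitaryGroup (Fin N) ℂ, ∀ α : ℝ, HasDerivAt (fun s => F s u) (F' α u) α := by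
    intro u α
    simp only [hF, hF']
    set R : ℝ := ((u : Matrix (Fin N) (Fin N) ℂ)).trace.re
    set J : ℝ := ((u : Matrix (Fin N) (Fin N) ℂ)).trace.im
    have h1 : HasDerivAt (fun s : ℝ => Real.sin s * R + Real.cos s * J) (Real.cos α * R - Real.sin α * J) α := by
      have h := ((Real.hasDerivAt_sin α).mul_const R).add ((Real.hasDerivAt_cos α).mul_const J)
      refine h.congr_deriv ?_
      ring
    have h2 : HasDerivAt (fun s : ℝ => Real.exp (β * (Real.cos s * R - Real.sin s * J)))
        (Real.exp (β * (Real.cos α * R - Real.sin α * J)) * (β * (-Real.sin α * R - Real.cos α * J))) α := by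
      have h := (((Real.hasDerivAt_cos α).mul_const R).sub ((Real.hasDerivAt_sin α).mul_const J)).const_mul β
      refine (h.exp).congr_deriv ?_
      simp only [Pi.sub_apply]
    refine (h1.mul h2).congr_deriv ?_
    ring
  -- uniform bound on the derivative
  have hbdR : ∀ u : Matrix.unitaryGroup (Fin N) ℂ, |((u : Matrix (Fin N) (Fin N) ℂ)).trace.re| ≤ N := fun u => by
    have h := abs_trace_re_le_card u
    rwa [Fintype.card_fin] at h
  have hbdJ : ∀ u : Matrix.unitaryGroup (Fin N) ℂ, |((u : Matrix (Fin N) (Fin N) ℂ)).trace.im| ≤ N := fun u => by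
    have h := abs_trace_im_le_card u
    rwa [Fintype.card_fin] at h
  have hbound : ∀ u : Matrix.unitaryGroup (Fin N) ℂ, ∀ α ∈ Set.Ioo (-1 : ℝ) 1, ‖F' α u‖
      ≤ (2 * N + |β| * (2 * N) ^ 2) * Real.exp (|β| * (2 * N)) := by
    intro u α _
    simp only [hF', Real.norm_eq_abs]
    set R : ℝ := ((u : Matrix (Fin N) (Fin N) ℂ)).trace.re
    set J : ℝ := ((u : Matrix (Fin N) (Fin N) ℂ)).trace.im
    have hc : |Real.cos α| ≤ 1 := Real.abs_cos_le_one α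
    have hs : |Real.sin α| ≤ 1 := Real.abs_sin_le_one α
    have hA : |Real.cos α * R - Real.sin α * J| ≤ 2 * N := by
      calc |Real.cos α * R - Real.sin α * J| ≤ |Real.cos α * R| + |Real.sin α * J| := abs_sub _ _
        _ = |Real.cos α| * |R| + |Real.sin α| * |J| := by rw [abs_mul, abs_mul]
        _ ≤ 1 * N + 1 * N := add_le_add (mul_le_mul hc (hbdR u) (abs_nonneg _) zero_le_one)
            (mul_le_mul hs (hbdJ u) (abs_nonneg _) zero_le_one)
        _ = 2 * N := by ring
    have hB : |Real.sin α * R + Real.cos α * J| ≤ 2 * N := by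
      calc |Real.sin α * R + Real.cos α * J| ≤ |Real.sin α * R| + |Real.cos α * J| := abs_add_le _ _
        _ = |Real.sin α| * |R| + |Real.cos α| * |J| := by rw [abs_mul, abs_mul]
        _ ≤ 1 * N + 1 * N := add_le_add (mul_le_mul hs (hbdR u) (abs_nonneg _) zero_le_one)
            (mul_le_mul hc (hbdJ u) (abs_nonneg _) zero_le_one)
        _ = 2 * N := by ring
    have hE : Real.exp (β * (Real.cos α * R - Real.sin α * J)) ≤ Real.exp (|β| * (2 * N)) := by
      refine Real.exp_le_exp.2 ?_
      calc β * (Real.cos α * R - Real.sin α * J) ≤ |β * (Real.cos α * R - Real.sin α * J)| := le_abs_self _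
        _ = |β| * |Real.cos α * R - Real.sin α * J| := abs_mul _ _
        _ ≤ |β| * (2 * N) := mul_le_mul_of_nonneg_left hA (abs_nonneg _)
    rw [abs_mul, abs_of_nonneg (Real.exp_nonneg _)]
    refine mul_le_mul ?_ hE (Real.exp_nonneg _) (by positivity)
    calc |Real.cos α * R - Real.sin α * J - β * (Real.sin α * R + Real.cos α * J) ^ 2|
        ≤ |Real.cos α * R - Real.sin α * J| + |β * (Real.sin α * R + Real.cos α * J) ^ 2| := abs_sub _ _
      _ = |Real.cos α * R - Real.sin α * J| + |β| * |Real.sin α * R + Real.cos α * J| ^ 2 := by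
          rw [abs_mul, abs_pow]
      _ ≤ 2 * N + |β| * (2 * N) ^ 2 := add_le_add hA (mul_le_mul_of_nonneg_left
          (pow_le_pow_left₀ (abs_nonneg _) hB 2) (abs_nonneg _))
  have hint0 : Integrable (F 0) μ := by
    refine Integrable.mono' (integrable_const ((2 * N) * Real.exp (|β| * (2 * N)))) (hcont 0).aestronglyMeasurable
      (Eventually.of_forall fun u => ?_)
    simp only [hF, Real.sin_zero, Real.cos_zero, zero_mul, one_mul, zero_add, sub_zero, Real.norm_eq_abs]
    rw [abs_mul, abs_of_nonneg (Real.exp_nonneg _)]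
    refine mul_le_mul ((hbdJ u).trans (by linarith)) (Real.exp_le_exp.2 ?_) (Real.exp_nonneg _) (by positivity)
    calc β * ((u : Matrix (Fin N) (Fin N) ℂ)).trace.re ≤ |β * ((u : Matrix (Fin N) (Fin N) ℂ)).trace.re| := le_abs_self _
      _ = |β| * |((u : Matrix (Fin N) (Fin N) ℂ)).trace.re| := abs_mul _ _
      _ ≤ |β| * (2 * N) := mul_le_mul_of_nonneg_left ((hbdR u).trans (by linarith)) (abs_nonneg _)
  have hD := hasDerivAt_integral_of_dominated_loc_of_deriv_le (μ := μ) (x₀ := (0 : ℝ))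
    (F := F) (F' := F') (s := Set.Ioo (-1 : ℝ) 1) (Ioo_mem_nhds (by norm_num) (by norm_num))
    (Eventually.of_forall fun α => (hcont α).aestronglyMeasurable) hint0 (hcont' 0).aestronglyMeasurable
    (Eventually.of_forall fun u α hα => hbound u α hα) (integrable_const _)
    (Eventually.of_forall fun u α _ => hderiv u α)
  -- the integral is constant in `α`, so its derivative vanishes
  have hD0 : HasDerivAt (fun α : ℝ => ∫ u, F α u ∂μ) 0 0 := by
    have h : (fun α : ℝ => ∫ u, F α u ∂μ) = fun _ => ∫ u, F 0 u ∂μ := funext hrot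
    rw [h]
    exact hasDerivAt_const 0 _
  have huniq := hD.2.unique hD0
  have hF'0 : ∀ u : Matrix.unitaryGroup (Fin N) ℂ, F' 0 u = ((((u : Matrix.unitaryGroup (Fin N) ℂ) : Matrix (Fin N) (Fin N) ℂ).trace.re
        - β * ((u : Matrix.unitaryGroup (Fin N) ℂ) : Matrix (Fin N) (Fin N) ℂ).trace.im ^ 2) *
        Real.exp (β * ((u : Matrix.unitaryGroup (Fin N) ℂ) : Matrix (Fin N) (Fin N) ℂ).trace.re)) := fun u => by
    simp only [hF', Real.sin_zero, Real.cos_zero, zero_mul, one_mul, zero_add, sub_zero]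
  simp_rw [hF'0] at huniq
  exact huniq

/-- **`β ∫_{U(N)} (Im tr U)² e^{β Re tr U} dU = ∫_{U(N)} Re tr U e^{β Re tr U} dU`**, every `N`, every real `β`. -/
theorem mul_integral_trace_im_sq_mul_exp (N : ℕ) (β : ℝ) :
    β * ∫ u, (((u : Matrix.unitaryGroup (Fin N) ℂ) : Matrix (Fin N) (Fin N) ℂ).trace.im ^ 2 *
        Real.exp (β * ((u : Matrix.unitaryGroup (Fin N) ℂ) : Matrix (Fin N) (Fin N) ℂ).trace.re))
        ∂(haarProbability (Matrix.unitaryGroup (Fin N) ℂ))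
      = ∫ u, (((u : Matrix.unitaryGroup (Fin N) ℂ) : Matrix (Fin N) (Fin N) ℂ).trace.re *
        Real.exp (β * ((u : Matrix.unitaryGroup (Fin N) ℂ) : Matrix (Fin N) (Fin N) ℂ).trace.re))
        ∂(haarProbability (Matrix.unitaryGroup (Fin N) ℂ)) := by
  have h := integral_trace_re_sub_mul_im_sq_mul_exp N β
  have htr : Continuous fun u : Matrix.unitaryGroup (Fin N) ℂ => ((u : Matrix (Fin N) (Fin N) ℂ)).trace :=
    continuous_subtype_val.matrix_trace
  have hR : Continuous fun u : Matrix.unitaryGroup (Fin N) ℂ => ((u : Matrix (Fin N) (Fin N) ℂ)).trace.re :=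
    Complex.continuous_re.comp htr
  have hJ : Continuous fun u : Matrix.unitaryGroup (Fin N) ℂ => ((u : Matrix (Fin N) (Fin N) ℂ)).trace.im :=
    Complex.continuous_im.comp htr
  have hbdR : ∀ u : Matrix.unitaryGroup (Fin N) ℂ, |((u : Matrix (Fin N) (Fin N) ℂ)).trace.re| ≤ N := fun u => by
    have h := abs_trace_re_le_card u
    rwa [Fintype.card_fin] at h
  have hbdJ : ∀ u : Matrix.unitaryGroup (Fin N) ℂ, |((u : Matrix (Fin N) (Fin N) ℂ)).trace.im| ≤ N := fun u => by
    have h := abs_trace_im_le_card u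
    rwa [Fintype.card_fin] at h
  have hexp_le : ∀ u : Matrix.unitaryGroup (Fin N) ℂ,
      Real.exp (β * ((u : Matrix (Fin N) (Fin N) ℂ)).trace.re) ≤ Real.exp (|β| * N) := fun u => by
    refine Real.exp_le_exp.2 ?_
    calc β * ((u : Matrix (Fin N) (Fin N) ℂ)).trace.re ≤ |β * ((u : Matrix (Fin N) (Fin N) ℂ)).trace.re| := le_abs_self _
      _ = |β| * |((u : Matrix (Fin N) (Fin N) ℂ)).trace.re| := abs_mul _ _
      _ ≤ |β| * N := mul_le_mul_of_nonneg_left (hbdR u) (abs_nonneg _)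
  have hce : Continuous fun u : Matrix.unitaryGroup (Fin N) ℂ => Real.exp (β * ((u : Matrix (Fin N) (Fin N) ℂ)).trace.re) :=
    Real.continuous_exp.comp (continuous_const.mul hR)
  have hint1 : Integrable (fun u : Matrix.unitaryGroup (Fin N) ℂ => ((u : Matrix (Fin N) (Fin N) ℂ)).trace.re *
      Real.exp (β * ((u : Matrix (Fin N) (Fin N) ℂ)).trace.re)) (haarProbability (Matrix.unitaryGroup (Fin N) ℂ)) := by
    refine Integrable.mono' (integrable_const ((N : ℝ) * Real.exp (|β| * N))) (hR.mul hce).aestronglyMeasurable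
      (Eventually.of_forall fun u => ?_)
    rw [Real.norm_eq_abs, abs_mul, abs_of_nonneg (Real.exp_nonneg _)]
    exact mul_le_mul (hbdR u) (hexp_le u) (Real.exp_nonneg _) (Nat.cast_nonneg N)
  have hint2 : Integrable (fun u : Matrix.unitaryGroup (Fin N) ℂ => β * (((u : Matrix (Fin N) (Fin N) ℂ)).trace.im ^ 2 *
      Real.exp (β * ((u : Matrix (Fin N) (Fin N) ℂ)).trace.re))) (haarProbability (Matrix.unitaryGroup (Fin N) ℂ)) := by
    refine Integrable.mono' (integrable_const (|β| * ((N : ℝ) ^ 2 * Real.exp (|β| * N))))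
      (continuous_const.mul ((hJ.pow 2).mul hce)).aestronglyMeasurable (Eventually.of_forall fun u => ?_)
    rw [Real.norm_eq_abs, abs_mul, abs_mul, abs_pow, abs_of_nonneg (Real.exp_nonneg _)]
    refine mul_le_mul_of_nonneg_left (mul_le_mul (pow_le_pow_left₀ (abs_nonneg _) (hbdJ u) 2) (hexp_le u)
      (Real.exp_nonneg _) (by positivity)) (abs_nonneg _)
  have hsplit : ∫ u, ((((u : Matrix.unitaryGroup (Fin N) ℂ) : Matrix (Fin N) (Fin N) ℂ).trace.re
        - β * ((u : Matrix.unitaryGroup (Fin N) ℂ) : Matrix (Fin N) (Fin N) ℂ).trace.im ^ 2) *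
        Real.exp (β * ((u : Matrix.unitaryGroup (Fin N) ℂ) : Matrix (Fin N) (Fin N) ℂ).trace.re))
      ∂(haarProbability (Matrix.unitaryGroup (Fin N) ℂ))
      = (∫ u, (((u : Matrix.unitaryGroup (Fin N) ℂ) : Matrix (Fin N) (Fin N) ℂ).trace.re *
          Real.exp (β * ((u : Matrix.unitaryGroup (Fin N) ℂ) : Matrix (Fin N) (Fin N) ℂ).trace.re))
          ∂(haarProbability (Matrix.unitaryGroup (Fin N) ℂ)))
        - β * ∫ u, (((u : Matrix.unitaryGroup (Fin N) ℂ) : Matrix (Fin N) (Fin N) ℂ).trace.im ^ 2 *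
          Real.exp (β * ((u : Matrix.unitaryGroup (Fin N) ℂ) : Matrix (Fin N) (Fin N) ℂ).trace.re))
          ∂(haarProbability (Matrix.unitaryGroup (Fin N) ℂ)) := by
    rw [← integral_const_mul, ← integral_sub hint1 hint2]
    refine integral_congr_ae (Eventually.of_forall fun u => ?_)
    ring
  rw [hsplit] at h
  linarith

/-! ### 3. Normalised forms -/

/-- **`β · ⟨(Im tr U)²⟩_β = N · P_N(β)`**: under the `U(N)` one-plaquette law `∝ e^{−β(N − Re tr U)} dU`, the second moment
of `Im tr U` is `β⁻¹` times the mean of `Re tr U` (every `N ≥ 1`, every real `β`; both sides vanish at `β = 0`). -/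
theorem unitary_mul_trace_im_sq_eq_plaquette (N : ℕ) [NeZero N] (β : ℝ) :
    β * ((∫ u, ((u : Matrix.unitaryGroup (Fin N) ℂ) : Matrix (Fin N) (Fin N) ℂ).trace.im ^ 2 *
          Real.exp (-(β * ((N : ℝ) - ((u : Matrix.unitaryGroup (Fin N) ℂ) : Matrix (Fin N) (Fin N) ℂ).trace.re)))
        ∂(haarProbability (Matrix.unitaryGroup (Fin N) ℂ)))
      / (∫ u, Real.exp (-(β * ((N : ℝ) - ((u : Matrix.unitaryGroup (Fin N) ℂ) : Matrix (Fin N) (Fin N) ℂ).trace.re)))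
        ∂(haarProbability (Matrix.unitaryGroup (Fin N) ℂ))))
      = N * ((∫ u, ((u : Matrix.unitaryGroup (Fin N) ℂ) : Matrix (Fin N) (Fin N) ℂ).trace.re / N *
          Real.exp (-(β * ((N : ℝ) - ((u : Matrix.unitaryGroup (Fin N) ℂ) : Matrix (Fin N) (Fin N) ℂ).trace.re)))
        ∂(haarProbability (Matrix.unitaryGroup (Fin N) ℂ)))
      / (∫ u, Real.exp (-(β * ((N : ℝ) - ((u : Matrix.unitaryGroup (Fin N) ℂ) : Matrix (Fin N) (Fin N) ℂ).trace.re)))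
        ∂(haarProbability (Matrix.unitaryGroup (Fin N) ℂ)))) := by
  have hsplit : ∀ u : Matrix.unitaryGroup (Fin N) ℂ,
      Real.exp (-(β * ((N : ℝ) - ((u : Matrix.unitaryGroup (Fin N) ℂ) : Matrix (Fin N) (Fin N) ℂ).trace.re)))
        = Real.exp (-(N * β)) * Real.exp (β * ((u : Matrix.unitaryGroup (Fin N) ℂ) : Matrix (Fin N) (Fin N) ℂ).trace.re) := by
    intro u; rw [← Real.exp_add]; congr 1; ring
  simp_rw [hsplit]
  have h1 : ∀ u : Matrix.unitaryGroup (Fin N) ℂ,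
      ((u : Matrix.unitaryGroup (Fin N) ℂ) : Matrix (Fin N) (Fin N) ℂ).trace.im ^ 2 *
        (Real.exp (-(N * β)) * Real.exp (β * ((u : Matrix.unitaryGroup (Fin N) ℂ) : Matrix (Fin N) (Fin N) ℂ).trace.re))
      = Real.exp (-(N * β)) * (((u : Matrix.unitaryGroup (Fin N) ℂ) : Matrix (Fin N) (Fin N) ℂ).trace.im ^ 2 *
          Real.exp (β * ((u : Matrix.unitaryGroup (Fin N) ℂ) : Matrix (Fin N) (Fin N) ℂ).trace.re)) := fun u => by ring
  have h2 : ∀ u : Matrix.unitaryGroup (Fin N) ℂ,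
      ((u : Matrix.unitaryGroup (Fin N) ℂ) : Matrix (Fin N) (Fin N) ℂ).trace.re / N *
        (Real.exp (-(N * β)) * Real.exp (β * ((u : Matrix.unitaryGroup (Fin N) ℂ) : Matrix (Fin N) (Fin N) ℂ).trace.re))
      = Real.exp (-(N * β)) / N * (((u : Matrix.unitaryGroup (Fin N) ℂ) : Matrix (Fin N) (Fin N) ℂ).trace.re *
          Real.exp (β * ((u : Matrix.unitaryGroup (Fin N) ℂ) : Matrix (Fin N) (Fin N) ℂ).trace.re)) := fun u => by ring
  simp_rw [h1, h2]
  rw [integral_const_mul, integral_const_mul, integral_const_mul, ← mul_integral_trace_im_sq_mul_exp N β,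
    integral_haar_unitaryGroup_fin_exp_mul_trace_re]
  have hZ := det_besselI_toeplitz_fin_pos N β
  have he : Real.exp (-(N * β)) ≠ 0 := (Real.exp_pos _).ne'
  have hN : (N : ℝ) ≠ 0 := Nat.cast_ne_zero.2 (NeZero.ne N)
  field_simp

/-- **`β · ⟨(Im tr U_p)²⟩_β → N` as `β → ∞`**, every `N ≥ 1` (the plaquette `P_N(β) → 1`, GEN-17). -/
theorem tendsto_mul_unitary_trace_im_sq_atTop (N : ℕ) [NeZero N] :
    Tendsto (fun β : ℝ => β * ((∫ u, ((u : Matrix.unitaryGroup (Fin N) ℂ) : Matrix (Fin N) (Fin N) ℂ).trace.im ^ 2 *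
          Real.exp (-(β * ((N : ℝ) - ((u : Matrix.unitaryGroup (Fin N) ℂ) : Matrix (Fin N) (Fin N) ℂ).trace.re)))
        ∂(haarProbability (Matrix.unitaryGroup (Fin N) ℂ)))
      / (∫ u, Real.exp (-(β * ((N : ℝ) - ((u : Matrix.unitaryGroup (Fin N) ℂ) : Matrix (Fin N) (Fin N) ℂ).trace.re)))
        ∂(haarProbability (Matrix.unitaryGroup (Fin N) ℂ))))) atTop (𝓝 (N : ℝ)) := by
  simp_rw [unitary_mul_trace_im_sq_eq_plaquette]
  have h := (tendsto_unitary_plaquette_atTop N).const_mul (N : ℝ)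
  rwa [mul_one] at h

end Summit.Ventures.LatticeQCDFlow.Scoring
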